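import Summits.QuantumFields.YangMills.Theorems.SwapVirialDeficitPeriodicContractGap
import Summits.QuantumFields.YangMills.Theorems.SwapVirialDeficitBlowUpPeriodicTwoScaleChart
import HarnessLib

/-!
# The PERIODIC massive-mode rung, brick PM-IV′: the fixed-`L` relative gap from the two-scale LIMIT (I3′) ALONE — (I1′) and (I2′) DISCHARGED BY NAME
# (free-hands support of ⟨stmt-QuantumFields-24196⟩ `SwapVirialDeficit.ToronSoftnessSharp`; composes ✓`relativeGap_fixedL_of_twoScale'` (PJ6), ✓`BlowUp.twoScale_upper/lower`
# (PM-III) with LEAD ym-line-sfw-p2 g96's PM-I ✓`periodicKernel_eq_twoScaleVolume` (I1′) and ✓`twoScaleVolume_le` (I2′, stated on the disc `a₀² + u² < 1`))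

★★★ `relativeGap_fixedL_of_twoScaleLimit`: for every `ε > 0` there is `L₀` such that for `L ≥ L₀`, ANY measurable bounded profile `M : ℝ → ℝ≥0∞` for which
`twoScaleVolume L u s a₀ → M a₀` locally uniformly off `a₀ = 0` (both halves of (I3′)) and `0 < ∫_{(−1,1)} 4π·M` yields, eventually in `β`,
`β·(log Z^S_L)′(β) − β·(log Z^{phys}_L)′(β) ≤ −(1/2 − 2ε)`.  Technical point: (I2′) as landed bounds `V` only ON THE DISC; `twoScale_upper_disc` clips `V` off the disc
(where the kernel vanishes anyway) and enlarges `Vmax` to dominate `M` too.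
HONEST LABEL: glue; the two-scale limit (I3′) = PM-IIb/c/d (LEAD g96) is NOT proved here; ⟨24196⟩/⟨24497⟩ OPEN; own crux ⟨22884⟩ OPEN (blocked-on ⟨19935⟩);
the Yang–Mills mass gap is NOT proved; no summit is proved by a line.  Width seat ym-line-sfw-p2-w3 g64 (cell ym-idea-1, free hands), `--supports stmt-QuantumFields-24196`.
THEOREMS ONLY (0 `def`, 0 `sorry`), standard axioms.  References: [cite: Luscher1983, §2]; [cite: GonzalezarroyoAltes1988]; [folklore].
-/

set_option autoImplicit false

noncomputable section

open MeasureTheory Set Filter Topology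
open scoped ENNReal
open Literature.MathematicalPhysics.QuantumLattice
open Literature.MathematicalPhysics.QuantumFieldTheory hiding SU2
open Summit.QuantumFields.YangMills.Theorems.SwapTwistDeficit.ToronLog

namespace Summit.QuantumFields.YangMills.Theorems.SwapVirialDeficit.BlowUp

/-- ★ **(hupper) with (I2′) ON THE DISC ONLY.**  As ✓`twoScale_upper`, but the crude bound `V u s a₀ ≤ Vmax` is required only for `a₀² + u² < 1`
(clip `V` to the disc: the kernel identity only ever evaluates `V` there). [folklore] -/
theorem twoScale_upper_disc (K : ℝ → ℝ × ℝ → ℝ≥0∞) (V : ℝ → ℝ → ℝ → ℝ≥0∞) (M : ℝ → ℝ≥0∞) {Vmax : ℝ≥0∞} (hVmax : Vmax ≠ ∞)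
    (hK : ∀ t a₀ ρ : ℝ, 0 < t → 0 < ρ → a₀ ^ 2 + ρ ^ 2 < 1 →
      K t (a₀, ρ) = ENNReal.ofReal (4 * Real.pi) * ENNReal.ofReal ρ⁻¹ * V ρ (t / ρ ^ 2) a₀)
    (hK0 : ∀ t a₀ ρ : ℝ, 0 < t → 0 < ρ → 1 ≤ a₀ ^ 2 + ρ ^ 2 → K t (a₀, ρ) = 0)
    (hV : ∀ u s a₀ : ℝ, 0 < u → 0 < s → a₀ ^ 2 + u ^ 2 < 1 → V u s a₀ ≤ Vmax) (hM : Measurable M) (hMV : ∀ a₀, M a₀ ≤ Vmax)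
    (hup : ∀ ε : ℝ, 0 < ε → ∀ r₀ ∈ Ioo (0 : ℝ) 1, ∃ θ : ℝ, 0 < θ ∧ ∀ a₀ : ℝ, r₀ ≤ |a₀| → |a₀| ≤ 1 →
      ∀ u ∈ Ioo (0 : ℝ) θ, ∀ s ∈ Ioo (0 : ℝ) θ, V u s a₀ ≤ M a₀ + ENNReal.ofReal ε)
    {ε : ℝ} (hε : 0 < ε) :
    ∃ A δ : ℝ, 0 < A ∧ 0 < δ ∧ ∃ G : ℝ → ℝ≥0∞,
      ∫⁻ x, G x ∂(volume : Measure ℝ) ≤ ENNReal.ofReal ((∫⁻ a₀ in Ioo (-1 : ℝ) 1, ENNReal.ofReal (4 * Real.pi) * M a₀ ∂volume).toReal + ε) ∧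
      ∀ᶠ t in 𝓝[>] (0 : ℝ), ∀ a₀ : ℝ, ∀ ρ ∈ Ioc (A * Real.sqrt t) δ, K t (a₀, ρ) ≤ G a₀ * ENNReal.ofReal ρ⁻¹ := by
  classical
  -- clip V to the disc
  refine twoScale_upper K (fun u s a₀ => if a₀ ^ 2 + u ^ 2 < 1 then V u s a₀ else 0) M hVmax (fun t a₀ ρ ht hρ hin => ?_) hK0
    (fun u s a₀ hu _ hs _ => ?_) hM hMV (fun ε' hε' r₀ hr₀ => ?_) hε
  · simp only [if_pos hin]; exact hK t a₀ ρ ht hρ hin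
  · by_cases h : a₀ ^ 2 + u ^ 2 < 1
    · simp only [if_pos h]; exact hV u s a₀ hu hs h
    · simp only [if_neg h]; exact bot_le
  · obtain ⟨θ, hθ, h⟩ := hup ε' hε' r₀ hr₀
    refine ⟨θ, hθ, fun a₀ h1 h2 u hu s hs => ?_⟩
    by_cases hd : a₀ ^ 2 + u ^ 2 < 1
    · simp only [if_pos hd]; exact h a₀ h1 h2 u hu s hs
    · simp only [if_neg hd]; exact bot_le

end Summit.QuantumFields.YangMills.Theorems.SwapVirialDeficit.BlowUp

namespace Summit.QuantumFields.YangMills.Theorems.SwapVirialDeficit.BlowUpRing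

open Summit.QuantumFields.YangMills.Theorems.FemtoTransferGap
open Summit.QuantumFields.YangMills.Theorems.FemtoTransferGap.TT
open Summit.QuantumFields.YangMills.Theorems.SwapVirialDeficit.BlowUp (twoScale_upper_disc twoScale_lower)

/-- ★★★ **THE FIXED-`L` RELATIVE GAP FROM THE TWO-SCALE LIMIT (I3′) ALONE** ((I1′) = ✓`periodicKernel_eq_twoScaleVolume`, (I2′) = ✓`twoScaleVolume_le`
discharged by name). [cite: Luscher1983, §2] [cite: GonzalezarroyoAltes1988] -/
theorem relativeGap_fixedL_of_twoScaleLimit {ε : ℝ} (hε : 0 < ε) :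
    ∃ L₀ : ℕ, ∀ (L : ℕ) [NeZero L], L₀ ≤ L →
      ∀ (M : ℝ → ℝ≥0∞) (Mmax : ℝ≥0∞), Mmax ≠ ∞ → Measurable M → (∀ a₀, M a₀ ≤ Mmax) →
      (∀ ε' : ℝ, 0 < ε' → ∀ r₀ ∈ Ioo (0 : ℝ) 1, ∃ θ : ℝ, 0 < θ ∧ ∀ a₀ : ℝ, r₀ ≤ |a₀| → |a₀| ≤ 1 →
        ∀ u ∈ Ioo (0 : ℝ) θ, ∀ s ∈ Ioo (0 : ℝ) θ, twoScaleVolume L u s a₀ ≤ M a₀ + ENNReal.ofReal ε') →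
      (∀ ε' : ℝ, 0 < ε' → ∀ r₀ ∈ Ioo (0 : ℝ) 1, ∃ θ : ℝ, 0 < θ ∧ ∀ a₀ : ℝ, r₀ ≤ |a₀| → |a₀| ≤ 1 →
        ∀ u ∈ Ioo (0 : ℝ) θ, ∀ s ∈ Ioo (0 : ℝ) θ, M a₀ ≤ twoScaleVolume L u s a₀ + ENNReal.ofReal ε') →
      0 < (∫⁻ a₀ in Ioo (-1 : ℝ) 1, ENNReal.ofReal (4 * Real.pi) * M a₀ ∂volume).toReal →
      ∃ β₀ : ℝ, ∀ β : ℝ, β₀ ≤ β →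
        β * deriv (fun b : ℝ => Real.log (TT.twistTrace L b (2 * L))) β -
            β * deriv (fun b : ℝ => Real.log (TT.physTrace L b (2 * L))) β ≤ -(1 / 2 - 2 * ε) := by
  obtain ⟨L₀, h⟩ := relativeGap_fixedL_of_twoScale' hε
  refine ⟨L₀, fun L _ hL M Mmax hMmax hM hMV hup hlo hgI => ?_⟩
  obtain ⟨Vmax, hVmax, hV⟩ := twoScaleVolume_le (L := L)
  -- one bound dominating both V (on the disc) and M
  have hVmax' : max Vmax Mmax ≠ ∞ := by simp [hVmax, hMmax]
  refine h L hL hgI (fun ε' hε' => ?_) (fun ε' hε' => ?_)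
  · exact twoScale_upper_disc (fun t p => periodicKernel L (fun _ => false) (fun _ => 1) t (t ^ 2) p) (twoScaleVolume L) M hVmax'
      (fun t a₀ ρ _ hρ hin => periodicKernel_eq_twoScaleVolume t hρ hin) (fun t a₀ ρ _ _ hle => periodicKernel_eq_zero_of_le L _ _ _ _ a₀ ρ hle)
      (fun u s a₀ hu hs hd => (hV u s a₀ hu hs hd).trans (le_max_left _ _)) hM (fun a₀ => (hMV a₀).trans (le_max_right _ _)) hup hε'
  · exact twoScale_lower (fun t p => periodicKernel L (fun _ => false) (fun _ => 1) t (t ^ 2) p) (twoScaleVolume L) M hVmax'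
      (fun t a₀ ρ _ hρ hin => periodicKernel_eq_twoScaleVolume t hρ hin) hM (fun a₀ => (hMV a₀).trans (le_max_right _ _)) hlo hε'

end Summit.QuantumFields.YangMills.Theorems.SwapVirialDeficit.BlowUpRing

end
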